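import Mathlib
import Summits.KontsevichZagierPeriods.Zeta5Search.FourthOrderShape
import Summits.KontsevichZagierPeriods.Zeta5Search.SecondResidueLaw
import Summits.KontsevichZagierPeriods.Zeta5Search.SecondOrderLive
import HarnessLib

/-!
# ζ(5) search — DOMINATION DATA of T-shapes: `isRaiseN k T S` ⇒ `S` dominates `T` at some offset (tools for THEOREM L5)

Cell `pub-zeta5` (HONEST FRAMING: systematic search; no irrationality claim unless certified), typer seat generation 13.
The shape clauses of `SecondResidueLaw.LawA5` (`LawA4Classes`: type `T`, `isRaise T S`, `isRaise2 T S`; `ShapeClause`: `isRaiseN 3 T S`)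
are Boolean statements about LISTS.  The shape theorem (`FourthOrderShape`) wants DOMINATION DATA for exponent functions: an
offset `a` with `a + L ≤ L'`, `f m ≥ ẽ m` on all levels (`ẽ = coreExt L a e`), and `f m ≥ 1` off the core.  This file bridges the two:
* `Dominates L e L' f a` (the three conditions), stable under `raiseAt`, `consOne` (offset `+1`), `snocOne`, composition (`Dominates.trans`),
  change of the functions off the levels, and REVERSAL (`Dominates.reverse`: for a palindromic `e`, `m ↦ f (L' − m)` dominates at
  offset `L' − L − a` — the conjugate class);
* `dominates_of_isRaiseN` — **`isRaiseN k T S = true`, `S ≠ []` ⇒ `∃ a, Dominates (tTop T) (tList T) (tTop S) (tList S) a`** (induction on `k`);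
  `dominates_of_isRaise`, `dominates_of_isRaise2`, `dominates_of_eq` (the `LawA4Classes` forms);
* `dominates_class` — the class form: exponents `k ↦ netExp b (x + kp)` on the levels `0..topLevel`.
Pure list/integer bookkeeping; nothing here bears on irrationality.
-/

open Finset

namespace Summit.KontsevichZagierPeriods.Zeta5Search.SecondOrder

open Summit.KontsevichZagierPeriods.Zeta5Search.ClusterValuation
open Summit.KontsevichZagierPeriods.Zeta5Search.CasoratianValuation (InPolytope)
open Summit.KontsevichZagierPeriods.Zeta5Search.SecondResidueLaw (isRaiseN)

variable {p : ℕ} [hp : Fact p.Prime]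

/-! ## §1 Domination -/

/-- `S = (L', f)` DOMINATES `T = (L, e)` at offset `a`: the core `a..a+L` fits, `f ≥ ẽ` everywhere, and `f ≥ 1` off the core. -/
def Dominates (L : ℕ) (e : ℕ → ℤ) (L' : ℕ) (f : ℕ → ℤ) (a : ℕ) : Prop :=
  a + L ≤ L' ∧ (∀ m ≤ L', coreExt L a e m ≤ f m) ∧ (∀ m ≤ L', (m < a ∨ a + L < m) → 1 ≤ f m)

namespace Dominates

omit hp in
/-- The core fits. -/
theorem le {L : ℕ} {e : ℕ → ℤ} {L' : ℕ} {f : ℕ → ℤ} {a : ℕ} (h : Dominates L e L' f a) : a + L ≤ L' := h.1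

omit hp in
/-- Entrywise domination. -/
theorem dom {L : ℕ} {e : ℕ → ℤ} {L' : ℕ} {f : ℕ → ℤ} {a : ℕ} (h : Dominates L e L' f a) :
    ∀ m ≤ L', coreExt L a e m ≤ f m := h.2.1

omit hp in
/-- Prefix and suffix levels are zeros. -/
theorem pos {L : ℕ} {e : ℕ → ℤ} {L' : ℕ} {f : ℕ → ℤ} {a : ℕ} (h : Dominates L e L' f a) :
    ∀ m ≤ L', (m < a ∨ a + L < m) → 1 ≤ f m := h.2.2

omit hp in
/-- `T` dominates itself at offset `0`. -/
theorem refl (L : ℕ) (e : ℕ → ℤ) : Dominates L e L e 0 := by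
  refine ⟨by omega, fun m hm => ?_, fun m hm h => by omega⟩
  rw [coreExt, if_pos ⟨Nat.zero_le _, by omega⟩, Nat.sub_zero]

omit hp in
/-- Changing `f` off the levels `0..L'` (or not at all) is harmless. -/
theorem congr_right {L : ℕ} {e : ℕ → ℤ} {L' : ℕ} {f f' : ℕ → ℤ} {a : ℕ} (h : Dominates L e L' f a)
    (hf : ∀ m ≤ L', f m = f' m) : Dominates L e L' f' a := by
  refine ⟨h.le, fun m hm => ?_, fun m hm h' => ?_⟩
  · rw [← hf m hm]; exact h.dom m hm
  · rw [← hf m hm]; exact h.pos m hm h'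

omit hp in
/-- Changing `e` off the levels `0..L` is harmless. -/
theorem congr_left {L : ℕ} {e e' : ℕ → ℤ} {L' : ℕ} {f : ℕ → ℤ} {a : ℕ} (h : Dominates L e L' f a)
    (he : ∀ j ≤ L, e j = e' j) : Dominates L e' L' f a := by
  refine ⟨h.le, fun m hm => ?_, h.pos⟩
  have := h.dom m hm
  unfold coreExt at this ⊢
  split_ifs with hc
  · rw [if_pos hc, he (m - a) (by omega)] at this; exact this
  · rw [if_neg hc] at this; exact this

omit hp in
/-- A raise at a level keeps domination. -/
theorem raiseAt {L : ℕ} {e : ℕ → ℤ} {L' : ℕ} {f : ℕ → ℤ} {a : ℕ} (h : Dominates L e L' f a) (k : ℕ) :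
    Dominates L e L' (SecondOrder.raiseAt f k) a := by
  refine ⟨h.le, fun m hm => ?_, fun m hm h' => ?_⟩
  · have := h.dom m hm; unfold SecondOrder.raiseAt; split_ifs <;> omega
  · have := h.pos m hm h'; unfold SecondOrder.raiseAt; split_ifs <;> omega

omit hp in
/-- A new first zero level shifts the offset by one. -/
theorem consOne {L : ℕ} {e : ℕ → ℤ} {L' : ℕ} {f : ℕ → ℤ} {a : ℕ} (h : Dominates L e L' f a) :
    Dominates L e (L' + 1) (SecondOrder.consOne f) (a + 1) := by
  refine ⟨by have := h.le; omega, fun m hm => ?_, fun m hm h' => ?_⟩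
  · unfold SecondOrder.consOne coreExt
    by_cases hm0 : m = 0
    · subst hm0; rw [if_pos rfl, if_neg (by omega)]; norm_num
    · rw [if_neg hm0]
      have := h.dom (m - 1) (by omega)
      unfold coreExt at this
      by_cases hc : a + 1 ≤ m ∧ m ≤ a + 1 + L
      · rw [if_pos hc]; rw [if_pos (by omega)] at this
        rwa [show m - (a + 1) = m - 1 - a by omega]
      · rw [if_neg hc]; rw [if_neg (by omega)] at this; exact this
  · unfold SecondOrder.consOne
    by_cases hm0 : m = 0
    · subst hm0; simp
    · rw [if_neg hm0]; exact h.pos (m - 1) (by omega) (by omega)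

omit hp in
/-- A new last zero level keeps the offset. -/
theorem snocOne {L : ℕ} {e : ℕ → ℤ} {L' : ℕ} {f : ℕ → ℤ} {a : ℕ} (h : Dominates L e L' f a) :
    Dominates L e (L' + 1) (SecondOrder.snocOne f L') a := by
  refine ⟨by have := h.le; omega, fun m hm => ?_, fun m hm h' => ?_⟩
  · unfold SecondOrder.snocOne
    by_cases hmL : m = L' + 1
    · subst hmL; rw [if_pos rfl, coreExt_off L a e (by have := h.le; omega)]; norm_num
    · rw [if_neg hmL]; exact h.dom m (by omega)
  · unfold SecondOrder.snocOne
    by_cases hmL : m = L' + 1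
    · subst hmL; simp
    · rw [if_neg hmL]; exact h.pos m (by omega) h'

omit hp in
/-- **Composition**: if `U` dominates `T` at `a₀` and `S` dominates `U` at `a₁`, then `S` dominates `T` at `a₁ + a₀`. -/
theorem trans {L : ℕ} {e : ℕ → ℤ} {LU : ℕ} {u : ℕ → ℤ} {a₀ : ℕ} {L' : ℕ} {f : ℕ → ℤ} {a₁ : ℕ}
    (h₀ : Dominates L e LU u a₀) (h₁ : Dominates LU u L' f a₁) : Dominates L e L' f (a₁ + a₀) := by
  have hle₀ := h₀.le
  refine ⟨by have := h₁.le; omega, fun m hm => ?_, fun m hm h' => ?_⟩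
  · unfold coreExt
    by_cases hc : a₁ + a₀ ≤ m ∧ m ≤ a₁ + a₀ + L
    · rw [if_pos hc]
      have h1 := h₁.dom m hm
      rw [coreExt, if_pos ⟨by omega, by omega⟩] at h1
      have h0 := h₀.dom (m - a₁) (by omega)
      rw [coreExt, if_pos ⟨by omega, by omega⟩, show m - a₁ - a₀ = m - (a₁ + a₀) by omega] at h0
      exact h0.trans h1
    · rw [if_neg hc]
      by_cases hcU : a₁ ≤ m ∧ m ≤ a₁ + LU
      · have h1 := h₁.dom m hm
        rw [coreExt, if_pos hcU] at h1
        have h0 := h₀.pos (m - a₁) (by omega) (by omega)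
        omega
      · have := h₁.pos m hm (by omega); omega
  · by_cases hcU : a₁ ≤ m ∧ m ≤ a₁ + LU
    · have h1 := h₁.dom m hm
      rw [coreExt, if_pos hcU] at h1
      have h0 := h₀.pos (m - a₁) (by omega) (by omega)
      omega
    · exact h₁.pos m hm (by omega)

omit hp in
/-- **Reversal**: for a PALINDROMIC frame type, the reversed shape dominates at the complementary offset
(this is the conjugate class). -/
theorem reverse {L : ℕ} {e : ℕ → ℤ} {L' : ℕ} {f : ℕ → ℤ} {a : ℕ} (h : Dominates L e L' f a)
    (hpal : ∀ j ≤ L, e (L - j) = e j) : Dominates L e L' (fun m => f (L' - m)) (L' - L - a) := by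
  have hle := h.le
  refine ⟨by omega, fun m hm => ?_, fun m hm h' => h.pos (L' - m) (by omega) (by omega)⟩
  dsimp only
  unfold coreExt
  by_cases hc : L' - L - a ≤ m ∧ m ≤ L' - L - a + L
  · rw [if_pos hc]
    have h1 := h.dom (L' - m) (by omega)
    rw [coreExt, if_pos ⟨by omega, by omega⟩] at h1
    have e1 : e (m - (L' - L - a)) = e (L' - m - a) := by
      rw [← hpal (L' - m - a) (by omega)]; congr 1; omega
    rw [e1]; exact h1
  · rw [if_neg hc]
    have := h.pos (L' - m) (by omega) (by omega); omega

end Dominates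

/-! ## §2 From the Boolean shape predicates -/

omit hp in
/-- Level data of the three single raises of a non-empty list. -/
theorem tData_raises {T : List ℤ} (hT : T ≠ []) :
    (∀ i, tTop (raiseAtList T i) = tTop T ∧ ∀ k ≤ tTop T, tList (raiseAtList T i) k = raiseAt (tList T) i k) ∧
    (tTop (1 :: T) = tTop T + 1 ∧ ∀ k ≤ tTop T + 1, tList (1 :: T) k = consOne (tList T) k) ∧
    (tTop (T ++ [1]) = tTop T + 1 ∧ ∀ k ≤ tTop T + 1, tList (T ++ [1]) k = snocOne (tList T) (tTop T) k) := by
  have hT' := range_map_tList hT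
  refine ⟨fun i => ?_, ?_, ?_⟩
  · have h : (List.range (tTop T + 1)).map (raiseAt (tList T) i) = raiseAtList T i := by
      rw [← mapIdx_range_map, hT']; rfl
    exact tList_of_range_map h
  · have h : (List.range (tTop T + 1 + 1)).map (consOne (tList T)) = 1 :: T := by
      rw [← cons_range_map, hT']
    exact tList_of_range_map h
  · have h : (List.range (tTop T + 1 + 1)).map (snocOne (tList T) (tTop T)) = T ++ [1] := by
      rw [← snoc_range_map, hT']
    exact tList_of_range_map h

omit hp in
/-- The raises of the empty list are `[1]`, which dominates `([] : (0, 0))` at offset `0`. -/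
theorem dominates_nil_one : Dominates (tTop ([] : List ℤ)) (tList []) (tTop [(1 : ℤ)]) (tList [(1 : ℤ)]) 0 := by
  refine ⟨?_, ?_, ?_⟩
  · exact by simp [tTop]
  · exact fun m hm => by
      simp only [tTop, List.length_singleton, Nat.sub_self, nonpos_iff_eq_zero] at hm
      subst hm
      simp [coreExt, tList]
  · exact fun m hm h => by simp [tTop] at hm h; omega

omit hp in
/-- Unfolding `isRaiseN (k+1)`: some single raise `U` of `T` with `isRaiseN k U S`. -/
theorem isRaiseN_succ_iff (k : ℕ) (T S : List ℤ) : isRaiseN (k + 1) T S = true ↔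
    (∃ i < T.length, isRaiseN k (raiseAtList T i) S = true) ∨ isRaiseN k (1 :: T) S = true ∨ isRaiseN k (T ++ [1]) S = true := by
  simp [isRaiseN, List.any_eq_true]

omit hp in
/-- `isRaiseN 0 T S` is `S = T`. -/
theorem isRaiseN_zero_iff (T S : List ℤ) : isRaiseN 0 T S = true ↔ S = T := by
  simp [isRaiseN]

omit hp in
/-- **Domination from `isRaiseN`.** -/
theorem dominates_of_isRaiseN : ∀ (k : ℕ) (T S : List ℤ), isRaiseN k T S = true → S ≠ [] →
    ∃ a, Dominates (tTop T) (tList T) (tTop S) (tList S) a := by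
  intro k
  induction k with
  | zero =>
    intro T S h hS
    have hST : S = T := (isRaiseN_zero_iff T S).1 h
    subst hST
    exact ⟨0, Dominates.refl _ _⟩
  | succ k ih =>
    intro T S h hS
    rw [isRaiseN_succ_iff] at h
    by_cases hT : T = []
    · subst hT
      have h1 : isRaiseN k [1] S = true := by
        rcases h with ⟨i, hi, _⟩ | h | h
        · simp at hi
        · simpa using h
        · simpa using h
      obtain ⟨a₁, h₁⟩ := ih [1] S h1 hS
      exact ⟨a₁ + 0, Dominates.trans dominates_nil_one h₁⟩
    obtain ⟨hr, hc, hs⟩ := tData_raises hT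
    rcases h with ⟨i, -, hUS⟩ | hUS | hUS
    · obtain ⟨a₁, h₁⟩ := ih _ S hUS hS
      obtain ⟨htop, hlist⟩ := hr i
      refine ⟨a₁ + 0, Dominates.trans ((Dominates.refl _ _).raiseAt i) ?_⟩
      rw [← htop]
      exact h₁.congr_left fun j hj => hlist j (by omega)
    · obtain ⟨a₁, h₁⟩ := ih _ S hUS hS
      refine ⟨a₁ + 1, Dominates.trans (Dominates.refl _ _).consOne ?_⟩
      rw [← hc.1]
      exact h₁.congr_left fun j hj => hc.2 j (by omega)
    · obtain ⟨a₁, h₁⟩ := ih _ S hUS hS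
      refine ⟨a₁ + 0, Dominates.trans (Dominates.refl _ _).snocOne ?_⟩
      rw [← hs.1]
      exact h₁.congr_left fun j hj => hs.2 j (by omega)

omit hp in
/-- `isRaise T S` is `isRaiseN 1 T S`. -/
theorem isRaiseN_one_of_isRaise {T S : List ℤ} (h : isRaise T S = true) : isRaiseN 1 T S = true := by
  rw [isRaiseN_succ_iff]
  simp only [isRaiseN_zero_iff]
  unfold isRaise at h
  simp only [Bool.or_eq_true, List.any_eq_true, List.mem_range, beq_iff_eq] at h
  rcases h with (⟨i, hi, hS⟩ | hS) | hS
  · exact Or.inl ⟨i, hi, hS⟩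
  · exact Or.inr (Or.inl hS)
  · exact Or.inr (Or.inr hS)

omit hp in
/-- `mapIdx` with the identity step. -/
theorem mapIdx_id' (W : List ℤ) : W.mapIdx (fun _ e => e) = W := by
  apply List.ext_getElem
  · simp
  · intro i h1 h2; simp

omit hp in
/-- `isRaise2 T S` implies `isRaiseN 2 T S`. -/
theorem isRaiseN_two_of_isRaise2 {T S : List ℤ} (h : isRaise2 T S = true) : isRaiseN 2 T S = true := by
  -- `isRaiseN 2 T S`: some raise `U` of `T` and some raise of `U` equal to `S`
  have key : ∀ U : List ℤ, ((∃ i < T.length, U = raiseAtList T i) ∨ U = 1 :: T ∨ U = T ++ [1]) →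
      ((∃ i < U.length, S = raiseAtList U i) ∨ S = 1 :: U ∨ S = U ++ [1]) → isRaiseN 2 T S = true := by
    intro U hU hV
    rw [show (2 : ℕ) = 1 + 1 from rfl, isRaiseN_succ_iff]
    simp only [isRaiseN_succ_iff, isRaiseN_zero_iff]
    rcases hU with ⟨i, hi, rfl⟩ | rfl | rfl
    · exact Or.inl ⟨i, hi, hV⟩
    · exact Or.inr (Or.inl hV)
    · exact Or.inr (Or.inr hV)
  have hlenR : ∀ i, (raiseAtList T i).length = T.length := fun i => by simp [raiseAtList]
  unfold isRaise2 at h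
  simp only [Bool.or_eq_true, List.any_eq_true, List.mem_range, beq_iff_eq] at h
  rcases h with ((((⟨a, ha, c, hc, hS⟩ | ⟨a, ha, hS⟩) | hS) | hS) | hS)
  · exact key _ (Or.inl ⟨a, ha, rfl⟩) (Or.inl ⟨c, by rw [hlenR]; exact hc, hS⟩)
  · rcases hS with hS | hS
    · exact key _ (Or.inl ⟨a, ha, rfl⟩) (Or.inr (Or.inl hS))
    · exact key _ (Or.inl ⟨a, ha, rfl⟩) (Or.inr (Or.inr hS))
  · -- `2 :: T` = raise of `1 :: T` at level `0`
    refine key _ (Or.inr (Or.inl rfl)) (Or.inl ⟨0, by simp, ?_⟩)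
    rw [hS]
    simp [raiseAtList, List.mapIdx_cons, mapIdx_id']
  · -- `T ++ [2]` = raise of `T ++ [1]` at the last level
    refine key _ (Or.inr (Or.inr rfl)) (Or.inl ⟨T.length, by simp, ?_⟩)
    rw [hS]
    apply List.ext_getElem
    · simp [raiseAtList]
    · intro i h1 h2
      simp only [raiseAtList, List.getElem_mapIdx]
      by_cases hi : i = T.length
      · subst hi; simp
      · have hi' : i < T.length := by simp at h1; omega
        simp [List.getElem_append_left (by simpa using hi'), hi]
  · -- `1 :: (T ++ [1])` = `(1 :: T) ++ [1]`
    exact key _ (Or.inr (Or.inl rfl)) (Or.inr (Or.inr (by rw [hS]; simp)))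

omit hp in
/-- **Domination for the clause forms of `LawA4Classes` / `ShapeClause`.** -/
theorem dominates_of_eq {T S : List ℤ} (h : S = T) (hS : S ≠ []) : ∃ a, Dominates (tTop T) (tList T) (tTop S) (tList S) a :=
  dominates_of_isRaiseN 0 T S (by subst h; simp [isRaiseN]) hS

omit hp in
/-- Domination from `isRaise`. -/
theorem dominates_of_isRaise {T S : List ℤ} (h : isRaise T S = true) (hS : S ≠ []) :
    ∃ a, Dominates (tTop T) (tList T) (tTop S) (tList S) a :=
  dominates_of_isRaiseN 1 T S (isRaiseN_one_of_isRaise h) hS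

omit hp in
/-- Domination from `isRaise2`. -/
theorem dominates_of_isRaise2 {T S : List ℤ} (h : isRaise2 T S = true) (hS : S ≠ []) :
    ∃ a, Dominates (tTop T) (tList T) (tTop S) (tList S) a :=
  dominates_of_isRaiseN 2 T S (isRaiseN_two_of_isRaise2 h) hS

/-! ## §3 The class form -/

/-- **Domination data of a class from its type list.**  If the type list of the class of `x` (levels `0..topLevel`) dominates
`T`, then so does its exponent function `k ↦ netExp(x + kp)`. -/
theorem dominates_class (b : ℕ → ℤ) {x : ℕ} (hxn : x ≤ (b 0).toNat) {T : List ℤ} {a : ℕ}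
    (h : Dominates (tTop T) (tList T) (tTop (classTypeList b p x)) (tList (classTypeList b p x)) a) :
    Dominates (tTop T) (tList T) (topLevel b p x) (fun k => netExp b (x + k * p)) a := by
  obtain ⟨htop, hlist⟩ := spec_of_typeList (p := p) b hxn (rfl : classTypeList b p x = classTypeList b p x)
  rw [htop] at h
  exact h.congr_right fun m hm => (hlist m hm).symm

omit hp in
/-- A class type list is never empty. -/
theorem classTypeList_ne_nil (b : ℕ → ℤ) (p x : ℕ) : classTypeList b p x ≠ [] := by
  simp [classTypeList]

end Summit.KontsevichZagierPeriods.Zeta5Search.SecondOrder
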